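import Mathlib
import Literature.NumberTheory.Sieve.CoprimeSquarefreeSums
import Literature.NumberTheory.Sieve.AsymptoticSieveForPrimesS2
import Summits.Parity.GeneralizedHardyLittlewood.Theses.LiouvilleShiftedTables

/-!
# `PairsFromMAvg`, part 5: opening `Λ = μ ⋆ log` in `∑_{n ≤ N} Λ(n) Λ(n+h)` and splitting at `m ≤ M₀`

Route `LiouvilleShiftedTables` (Parity / GeneralizedHardyLittlewood), support item stmt-Parity-14275
(`PairsFromMAvg`). Bombieri's level-1 decomposition: with `F(d, m) = μ(d) log m · Λ(dm + h)`,

  `∑_{n ≤ N} Λ(n)Λ(n+h) = ∑_{dm ≤ N} F(d,m) = P₁ + P₂`,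
  `P₁ = ∑_{m ≤ M₀} log m ∑_{d ≤ N/m} μ(d)Λ(dm+h)` (the `MAvg` expression at `x = N`, `M₀ = ⌊N^ε⌋`),
  `P₂ = ∑_{d ≤ N} μ(d) T_d`, `T_d = ∑_{M₀ < m ≤ N/d} log m Λ(dm+h)` (`T_d = 0` unless `d(M₀+1) ≤ N`).

* `sum_vonMangoldt_mul_shift_eq_add` — the split `= P₁ + P₂` (for `M₀ ≤ N`);
* `abs_smallPart_le` — `|P₁| ≤ ∑_{m ≤ M₀} log m |∑_{d ≤ N/m} μ(d)Λ(dm+h)|`;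
* `largePart_eq_sum_Icc_div` — `P₂ = ∑_{d ≤ N/(M₀+1)} μ(d) T_d`.

[cite: BombieriAsymptoticSieve1976, §1; folklore]
-/

noncomputable section

open Finset Real ArithmeticFunction Filter
open scoped ArithmeticFunction.Moebius

namespace Summit.Parity.GeneralizedHardyLittlewood.Theorems.PairsFromMAvg

/-- `Λ(n)Λ(n+h)` opened: `∑_{n ≤ N} Λ(n)Λ(n+h) = ∑_{n ≤ N} ∑_{dm = n} μ(d) log m Λ(dm+h)`
(Mathlib's `moebius_mul_log_eq_vonMangoldt`). [folklore] -/
theorem sum_vonMangoldt_mul_shift_eq_sum_antidiagonal (h N : ℕ) :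
    ∑ n ∈ Icc 1 N, Λ n * Λ (n + h) =
      ∑ n ∈ Icc 1 N, ∑ q ∈ n.divisorsAntidiagonal,
        (μ q.1 : ℝ) * Real.log q.2 * Λ (q.1 * q.2 + h) := by
  refine Finset.sum_congr rfl fun n _ => ?_
  have e : Λ n = ((μ : ArithmeticFunction ℝ) * ArithmeticFunction.log) n := by
    rw [moebius_mul_log_eq_vonMangoldt]
  rw [e, mul_apply, Finset.sum_mul]
  refine Finset.sum_congr rfl fun q hq => ?_
  rw [(Nat.mem_divisorsAntidiagonal.mp hq).1, intCoe_apply, log_apply]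

/-- `(Icc 1 K).filter (M₀ < ·) = Ioc M₀ K`. [folklore] -/
theorem filter_lt_Icc_eq_Ioc (M₀ K : ℕ) :
    (Icc 1 K).filter (fun m => M₀ < m) = Ioc M₀ K := by
  ext m
  simp only [Finset.mem_filter, Finset.mem_Icc, Finset.mem_Ioc]
  omega

/-- `(Icc 1 N).filter (· ≤ M₀) = Icc 1 M₀` for `M₀ ≤ N`. [folklore] -/
theorem filter_le_Icc_eq_Icc {M₀ N : ℕ} (hM : M₀ ≤ N) :
    (Icc 1 N).filter (fun m => m ≤ M₀) = Icc 1 M₀ := by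
  ext m
  simp only [Finset.mem_filter, Finset.mem_Icc]
  omega

/-- **The level-1 split** (`M₀ ≤ N`):
`∑_{n ≤ N} Λ(n)Λ(n+h) = ∑_{m ≤ M₀} log m ∑_{d ≤ N/m} μ(d)Λ(dm+h) + ∑_{d ≤ N} μ(d) ∑_{M₀ < m ≤ N/d} log m Λ(dm+h)`.
[cite: BombieriAsymptoticSieve1976, §1] -/
theorem sum_vonMangoldt_mul_shift_eq_add (h : ℕ) {M₀ N : ℕ} (hM : M₀ ≤ N) :
    ∑ n ∈ Icc 1 N, Λ n * Λ (n + h) =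
      ∑ m ∈ Icc 1 M₀, Real.log m * ∑ d ∈ Icc 1 (N / m), (μ d : ℝ) * Λ (d * m + h) +
      ∑ d ∈ Icc 1 N, (μ d : ℝ) * ∑ m ∈ Ioc M₀ (N / d), Real.log m * Λ (d * m + h) := by
  classical
  set F : ℕ → ℕ → ℝ := fun d m => (μ d : ℝ) * Real.log m * Λ (d * m + h) with hF
  rw [sum_vonMangoldt_mul_shift_eq_sum_antidiagonal]
  have hsplit : ∀ n ∈ Icc 1 N, ∑ q ∈ n.divisorsAntidiagonal, F q.1 q.2 =
      ∑ q ∈ n.divisorsAntidiagonal, (if q.2 ≤ M₀ then F q.1 q.2 else 0) +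
      ∑ q ∈ n.divisorsAntidiagonal, (if M₀ < q.2 then F q.1 q.2 else 0) := by
    intro n _
    rw [← Finset.sum_add_distrib]
    refine Finset.sum_congr rfl fun q _ => ?_
    by_cases hq : q.2 ≤ M₀
    · rw [if_pos hq, if_neg (not_lt.mpr hq), add_zero]
    · rw [if_neg hq, if_pos (not_le.mp hq), zero_add]
  rw [Finset.sum_congr rfl hsplit, Finset.sum_add_distrib]
  congr 1
  · -- the small part, summed by `m`
    rw [Literature.NumberTheory.Sieve.sum_Icc_sum_divisorsAntidiagonal_eq
      (fun q : ℕ × ℕ => if q.2 ≤ M₀ then F q.1 q.2 else 0) N]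
    simp only []
    rw [← filter_le_Icc_eq_Icc hM, Finset.sum_filter]
    refine Finset.sum_congr rfl fun m _ => ?_
    split_ifs with hm
    · rw [Finset.mul_sum]
      refine Finset.sum_congr rfl fun d _ => ?_
      simp only [hF]; ring
    · simp
  · -- the large part, summed by `d`
    rw [Literature.NumberTheory.Sieve.SquarefreeSums.sum_Icc_sum_divisorsAntidiagonal
      (fun d m => if M₀ < m then F d m else 0) N]
    refine Finset.sum_congr rfl fun d _ => ?_
    rw [← Finset.sum_filter, filter_lt_Icc_eq_Ioc, Finset.mul_sum]
    refine Finset.sum_congr rfl fun m _ => ?_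
    simp only [hF]; ring

/-- `|P₁| ≤ ∑_{m ≤ M₀} log m |∑_{d ≤ N/m} μ(d)Λ(dm+h)|` (the `MAvg` expression). [folklore] -/
theorem abs_smallPart_le (h M₀ N : ℕ) :
    |∑ m ∈ Icc 1 M₀, Real.log m * ∑ d ∈ Icc 1 (N / m), (μ d : ℝ) * Λ (d * m + h)| ≤
      ∑ m ∈ Icc 1 M₀, Real.log m * |∑ d ∈ Icc 1 (N / m), (μ d : ℝ) * Λ (d * m + h)| := by
  refine (abs_sum_le_sum_abs _ _).trans (le_of_eq (Finset.sum_congr rfl fun m hm => ?_))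
  rw [abs_mul, abs_of_nonneg (Real.log_nonneg (by exact_mod_cast (Finset.mem_Icc.mp hm).1))]

/-- The inner range `M₀ < m ≤ N/d` is empty unless `d ≤ N/(M₀+1)`. [folklore] -/
theorem Ioc_div_eq_empty {M₀ N d : ℕ} (hd : N / (M₀ + 1) < d) : Ioc M₀ (N / d) = ∅ := by
  have hd0 : 0 < d := lt_of_le_of_lt (Nat.zero_le _) hd
  have h1 : N < d * (M₀ + 1) := (Nat.div_lt_iff_lt_mul (Nat.succ_pos M₀)).mp hd
  have h2 : N / d < M₀ + 1 :=
    (Nat.div_lt_iff_lt_mul hd0).mpr (by rw [mul_comm] at h1; exact h1)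
  rw [Finset.Ioc_eq_empty_iff, not_lt]
  exact Nat.lt_succ_iff.mp h2

/-- `P₂ = ∑_{d ≤ N/(M₀+1)} μ(d) T_d`: the moduli `d > N/(M₀+1)` contribute nothing. [folklore] -/
theorem largePart_eq_sum_Icc_div (h M₀ N : ℕ) :
    ∑ d ∈ Icc 1 N, (μ d : ℝ) * ∑ m ∈ Ioc M₀ (N / d), Real.log m * Λ (d * m + h) =
      ∑ d ∈ Icc 1 (N / (M₀ + 1)), (μ d : ℝ) * ∑ m ∈ Ioc M₀ (N / d), Real.log m * Λ (d * m + h) := by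
  refine (Finset.sum_subset (Finset.Icc_subset_Icc le_rfl (Nat.div_le_self _ _)) ?_).symm
  intro d hd hd'
  have hlt : N / (M₀ + 1) < d := by
    rw [Finset.mem_Icc] at hd hd'
    omega
  rw [Ioc_div_eq_empty hlt, Finset.sum_empty, mul_zero]

end Summit.Parity.GeneralizedHardyLittlewood.Theorems.PairsFromMAvg
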